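import Summits.Ventures.Crystal3D.Theorems.StickyWulffConstantGenericWallFloorBarlowOrbitFree
import HarnessLib

/-!
# Every step of the stack walk moves along the NEW top entry's direction; hence a direction floor gives monotone drift
# (crux `GenericWallFloor`, stmt-Ventures-19480, line `WallLedgerG`; lane G's W1-conditional ledger, cf-p1 (xxxix): hypothesis `hdirs`)

HONEST FRAMING. Venture `Summits/Ventures/Crystal3D` (cell `crystal3d-full`), helper `--supports` the crux `GenericWallFloor`
(stmt-Ventures-19480) of `route-Ventures-StickyWulffConstant`, registered line `WallLedgerG`, open stub `stub_twoSlabAdhesion`.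
Rung credit only; F-C1 not moved; NOT the stub.  Walk semantics only.

The W1-CONDITIONAL one-sided ledger (19480-p1 RISER-LEDGER-g8 §8, cf-p1 §86(86b): steered steep family, hypothesis
`hdirs : every reachable state's top direction has ⟪F v, e₃⟫ ≥ δ`, δ = 0.30) replaces the tilt toolkit's e₃-monotonicity
(`‖z − e₃‖ < 3/8`) by a floor on the HELD directions.  The bridge is the observation that a step of `walkStep` — full move, pop or
push — always displaces the walker by the direction of the top entry of the NEW state:

* (tree, `…WalkReach`) `walkStep_fst_eq_add_top` — `walkStep X z s = some s' → ∃ e rest, s'.2 = e :: rest ∧ s'.1 = s.1 + e.frame e.dir`;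
* **`walkRun_drift_of_dirFloor`** — if along the run every state's top entry `e` satisfies `‖e.frame e.dir‖ ≤ 1` and
  `δ ≤ ⟪e.frame e.dir, w⟫` (`w` any vector, e.g. `e₃`), then `δ·‖(walkRun k s).1 − s.1‖ ≤ ⟪(walkRun k s).1 − s.1, w⟫` and
  `0 ≤ ⟪(walkRun k s).1 − s.1, w⟫` — monotone `w`-height with drift `≤ 1/δ` per unit rise, the replacement for
  `walkRun_disp_le_of_tilt_ref_wide` in `…StackLedgerOneSidedWide`.
WHAT THIS IS NOT: not the ledger (g8: `…StackLedgerOneSidedDirs`); F-C1 not moved.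
-/

noncomputable section

namespace Summit.Ventures.Crystal3D.Theorems

open Finset
open scoped InnerProductSpace

variable {X : Finset (EuclideanSpace ℝ (Fin 3))}

/-- **Monotone height and bounded drift from a direction floor.**  If every state along the first `k` steps of the run from `s`
has a top entry `e` with `‖e.frame e.dir‖ ≤ 1` and `δ ≤ ⟪e.frame e.dir, w⟫` (`δ ≥ 0`), then `δ·‖Δ‖ ≤ ⟪Δ, w⟫` for the displacement
`Δ = (walkRun k s).1 − s.1` (each step moves along the new top direction, `walkStep_fst_eq_add_top`). -/
theorem walkRun_drift_of_dirFloor (z w : EuclideanSpace ℝ (Fin 3)) {δ : ℝ} (hδ0 : 0 ≤ δ) :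
    ∀ (k : ℕ) (s : EuclideanSpace ℝ (Fin 3) × List WalkEntry),
      (∀ j : ℕ, j ≤ k → ∀ e rest, (walkRun X z j s).2 = e :: rest → ‖e.frame e.dir‖ ≤ 1 ∧ δ ≤ ⟪e.frame e.dir, w⟫_ℝ) →
      δ * ‖(walkRun X z k s).1 - s.1‖ ≤ ⟪(walkRun X z k s).1 - s.1, w⟫_ℝ := by
  intro k
  induction k with
  | zero => intro s _; simp
  | succ k ih =>
    intro s hdirs
    obtain ⟨y, stk⟩ := s
    cases hst : walkStep X z (y, stk) with
    | none => rw [walkRun_succ_of_none X z k hst]; simp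
    | some s' =>
      rw [walkRun_succ_of_some X z k hst]
      obtain ⟨e', rest', hs'2, hs'1⟩ := walkStep_fst_eq_add_top hst
      -- the floor along the run from `s'`
      have hdirs' : ∀ j : ℕ, j ≤ k → ∀ e rest, (walkRun X z j s').2 = e :: rest → ‖e.frame e.dir‖ ≤ 1 ∧ δ ≤ ⟪e.frame e.dir, w⟫_ℝ := by
        intro j hj e rest h
        have h2 := hdirs (j + 1) (by omega) e rest
        rw [walkRun_succ_of_some X z j hst] at h2
        exact h2 h
      have hih := ih s' hdirs'
      obtain ⟨hn, hδ⟩ := hdirs' 0 (Nat.zero_le _) e' rest' (by simpa using hs'2)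
      have e1 : (walkRun X z k s').1 - (y, stk).1 = ((walkRun X z k s').1 - s'.1) + e'.frame e'.dir := by
        simp only [hs'1]; abel
      rw [e1, inner_add_left]
      have htri : ‖(walkRun X z k s').1 - s'.1 + e'.frame e'.dir‖ ≤ ‖(walkRun X z k s').1 - s'.1‖ + 1 :=
        (norm_add_le _ _).trans (by linarith)
      have h2 : δ * ‖(walkRun X z k s').1 - s'.1 + e'.frame e'.dir‖ ≤ δ * (‖(walkRun X z k s').1 - s'.1‖ + 1) :=
        mul_le_mul_of_nonneg_left htri hδ0
      linarith

end Summit.Ventures.Crystal3D.Theorems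

end
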